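import Summits.AtomisticToContinuum.Crystallization.Theorems.GappedShellCensusCleanLimitsHaveWindowsBoxPinningC
import Summits.AtomisticToContinuum.Crystallization.Theorems.GappedShellCensusCleanLimitsHaveWindowsLayerCakeBand

/-!
# `GappedShellCensus.CleanLimitsHaveWindows` (stmt-AtomisticToContinuum-15932), line `Sketch`:
# stub `stub_meanInplaneStress` (zero mean in-plane stress of layered hull elements)

Registered stub T4b-ii of the lead skeleton.  If the exactly layered set `A(S(a, s, z))` (in-plane
spacing `a ∈ [23/25, 51/50]`, height increments `≥ 3a/4`) lies in the hull of a sequence `x` of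
Lennard-Jones ground states, then for every `λ ∈ [99/100, 101/100]` and every height sequence `z'`
keeping the interlayer nearest-neighbour bond lengths (`Δ'² = Δ² + a²(1 − λ²)/3`, `Δ' > 0`) the window
sums of the layer-wise site-energy differences against the in-plane rescaled competitor
`A(S(λa, s, z'))` are bounded above by a constant `C` depending on nothing.

Proof.  On the prism `W = W(m₁, n, K)` of `S` (`n` layers of `K × K` sites) the hull upper bound (U)
of `LayeredHull.stub_windowBounds` and the layer cake on the clean band (`stub_layerCakeBand` for
`(a, s, z)`: `a ∈ [9/10, 11/10]`, increments `≥ 7a/10`) give `K² Σ_m ε_m ≤ 2E(nK²) + |C_U| C_c (nK + K²)`;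
on the prism `W'` of the `1/2`-separated competitor `S'` (layer cake for `(λa, s, z')`: `λa ∈ [9/10, 11/10]`
and `Δ' ≥ 7/10·λa` by `mis_increment_lower`) the free lower bound (L) (with `δ = 1/2`) gives
`K² Σ_m ε'_m ≥ 2E(nK²) − |C_L| C_c (nK + K²)` at the SAME cardinality `nK²`.  Subtracting,
`K² Σ_m (ε_m − ε'_m) ≤ (|C_U| + |C_L|) C_c (nK + K²)` for every `K ≥ 1`, whence
`Σ_m (ε_m − ε'_m) ≤ (|C_U| + |C_L|) C_c` (`bp_meanStress_le`, `K → ∞`).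
-/

noncomputable section

namespace Summit.AtomisticToContinuum.Crystallization.Theorems.CleanHull

open scoped BigOperators
open Filter Literature.MathematicalPhysics.StatisticalMechanics

/-! ## The competitor stays in the clean band -/

/-- **The competitor stays in the clean band.** For `a ∈ [23/25, 51/50]`, `λ ∈ [99/100, 101/100]`,
`Δ ≥ 3a/4` and `Δ' > 0` with `Δ'² = Δ² + a²(1 − λ²)/3`: `Δ' ≥ 7/10·(λa)`
(`Δ'² ≥ (9/16 − 0.0067)a² ≥ 0.49·λ²a²`). [folklore] -/
theorem mis_increment_lower {a lam Δ Δ' : ℝ} (ha0 : 23 / 25 ≤ a) (hl0 : 99 / 100 ≤ lam)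
    (hl1 : lam ≤ 101 / 100) (hΔ : 3 / 4 * a ≤ Δ) (hΔ' : Δ' ^ 2 = Δ ^ 2 + a ^ 2 * (1 - lam ^ 2) / 3)
    (hpos : 0 < Δ') : 7 / 10 * (lam * a) ≤ Δ' := by
  have ha : 0 < a := by linarith
  have hl : 0 < lam := by linarith
  have hsq : (7 / 10 * (lam * a)) ^ 2 ≤ Δ' ^ 2 := by
    have hl2 : lam ^ 2 ≤ (101 / 100) ^ 2 := pow_le_pow_left₀ hl.le hl1 2
    have hΔ2 : (3 / 4 * a) ^ 2 ≤ Δ ^ 2 := pow_le_pow_left₀ (by positivity) hΔ 2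
    have ha2 : 0 ≤ a ^ 2 := sq_nonneg a
    have hprod : a ^ 2 * lam ^ 2 ≤ a ^ 2 * (101 / 100) ^ 2 := mul_le_mul_of_nonneg_left hl2 ha2
    rw [hΔ']
    nlinarith [hΔ2, hprod, ha2]
  exact (pow_le_pow_iff_left₀ (by positivity) hpos.le two_ne_zero).1 hsq

/-! ## The stub -/

/-- **Stub T4b-ii (zero mean in-plane stress of layered hull elements).** If the exactly layered set `A(S(a, s, z))`
(spacing `a ∈ [23/25, 51/50]`, increments `≥ 7a/10·…`) lies in the hull of a sequence of Lennard-Jones ground states, then for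
every `λ ∈ [99/100, 101/100]` and every height sequence `z'` whose increments keep the interlayer bond lengths
(`Δ'² = Δ² + a²(1 − λ²)/3`), the window sums of the layer-wise site-energy differences against the in-plane rescaled competitor
`A(S(λa, s, z'))` are bounded: `Σ_{m ∈ [m₁, m₁+n)} (ε_m − ε'_m) ≤ C` ((U) − (L) on prisms at equal cardinality `nK²`, `K → ∞`).
[folklore] -/
theorem stub_meanInplaneStress :
    ∃ C : ℝ, ∀ (x : (N : ℕ) → (Fin N → EuclideanSpace ℝ (Fin 3))), (∀ N, IsGroundState lennardJones (x N)) →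
      ∀ (a : ℝ), 23 / 25 ≤ a → a ≤ 51 / 50 →
      ∀ (A : EuclideanSpace ℝ (Fin 3) →ₗᵢ[ℝ] EuclideanSpace ℝ (Fin 3)) (s : ℤ → ℤ) (z : ℤ → ℝ),
        (∀ m : ℤ, 3 / 4 * a ≤ z (m + 1) - z m) →
        (∀ R ε : ℝ, 0 < ε → ∃ᶠ N in atTop, ∃ t : EuclideanSpace ℝ (Fin 3),
          (∀ p ∈ {p : EuclideanSpace ℝ (Fin 3) | ∃ m i j : ℤ, p = A (((i : ℝ) • triangularVec₁ a) +
              ((j : ℝ) • triangularVec₂ a) + ((haggLabel s m : ℝ) • barlowOffset a) + (z m • layerNormal 1))},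
            ‖p‖ ≤ R → ∃ i : Fin N, dist (x N i + t) p ≤ ε) ∧
          (∀ i : Fin N, ‖x N i + t‖ ≤ R → ∃ p ∈ {p : EuclideanSpace ℝ (Fin 3) | ∃ m i j : ℤ,
              p = A (((i : ℝ) • triangularVec₁ a) + ((j : ℝ) • triangularVec₂ a) +
                ((haggLabel s m : ℝ) • barlowOffset a) + (z m • layerNormal 1))}, dist (x N i + t) p ≤ ε)) →
        ∀ (lam : ℝ), 99 / 100 ≤ lam → lam ≤ 101 / 100 → ∀ (z' : ℤ → ℝ),
          (∀ m : ℤ, (z' (m + 1) - z' m) ^ 2 = (z (m + 1) - z m) ^ 2 + a ^ 2 * (1 - lam ^ 2) / 3) →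
          (∀ m : ℤ, 0 < z' (m + 1) - z' m) →
          ∀ (m₁ : ℤ) (n : ℕ),
            ∑ m ∈ Finset.Ico m₁ (m₁ + n),
              ((inLayerInteraction lennardJones a + ∑' m' : ℤ, if m' = m then (0 : ℝ) else
                  layerInteraction lennardJones a (z m' - z m) (haggLabel s m' - haggLabel s m) 1) -
               (inLayerInteraction lennardJones (lam * a) + ∑' m' : ℤ, if m' = m then (0 : ℝ) else
                  layerInteraction lennardJones (lam * a) (z' m' - z' m) (haggLabel s m' - haggLabel s m) 1)) ≤ C := by
  classical
  -- the three constants, uniform in everything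
  obtain ⟨CU, hU'⟩ := LayeredHull.stub_windowBounds.1
  obtain ⟨CL, hL'⟩ := LayeredHull.stub_windowBounds.2 (1 / 2) (by norm_num)
  obtain ⟨Cc, hcake⟩ := stub_layerCakeBand
  refine ⟨(|CU| + |CL|) * Cc, ?_⟩
  intro x hx a ha0 ha1 A s z hz hH lam hl0 hl1 z' hz' hz'pos m₁ n
  have ha : 0 < a := by linarith
  -- layer cake for `(a, s, z)`
  obtain ⟨-, hcakeA⟩ := hcake a (by linarith) (by linarith)
  obtain ⟨-, -, -, hprismS⟩ := hcakeA A s z (fun m => by linarith [hz m])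
  -- layer cake for the competitor `(λa, s, z')`
  have hla0 : 9 / 10 ≤ lam * a := by nlinarith
  have hla1 : lam * a ≤ 11 / 10 := by nlinarith
  obtain ⟨-, hcakeB⟩ := hcake (lam * a) hla0 hla1
  obtain ⟨hsep', -, -, hprismS'⟩ := hcakeB A s z'
    (fun m => mis_increment_lower ha0 hl0 hl1 (hz m) (hz' m) (hz'pos m))
  -- the bound `K² Σ (ε − ε') ≤ (|C_U| + |C_L|) C_c (nK + K²)` for every `K ≥ 1`
  refine bp_meanStress_le m₁ n fun K _ => ?_
  obtain ⟨hWsub, hWcard, hWsum, hWbd⟩ := hprismS m₁ n K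
  obtain ⟨hW'sub, hW'card, hW'sum, hW'bd⟩ := hprismS' m₁ n K
  -- (U) for `W ⊆ S` (in the hull) and (L) for `W' ⊆ S'` (`1/2`-separated), same cardinality `nK²`
  have hUw := hU' x hx _ hH _ hWsub
  have hLw := hL' _ hsep' _ hW'sub
  rw [hWcard, hWsum] at hUw
  rw [hW'card, hW'sum] at hLw
  have hUw' := LayeredHull.clo_absorb_upper hUw hWbd (Finset.sum_nonneg fun p _ =>
    pow_nonneg (inv_nonneg.2 (add_nonneg zero_le_one Metric.infDist_nonneg)) 3)
  have hLw' := LayeredHull.clo_absorb_lower hLw hW'bd (Finset.sum_nonneg fun p _ =>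
    pow_nonneg (inv_nonneg.2 (add_nonneg zero_le_one Metric.infDist_nonneg)) 3)
  rw [Finset.sum_sub_distrib, mul_sub]
  linarith

end Summit.AtomisticToContinuum.Crystallization.Theorems.CleanHull

end
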